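import Summits.CriticalPhenomena.SAWScalingLimit.Theorems.SAWLeftRightFKGFKGToTraversalBoundSlitNecklaceDefs
import HarnessLib

/-!
# Germ tightness is NECESSARY: it follows from per-shell eventual tightness (stub `germTight_of_eventualShellTight`)

Crux `SAWLeftRightFKG.FKGToTraversalBound` (stmt-CriticalPhenomena-1878), line `slit-necklace`, lead c6.  The line's necklace
reduction consumes germ tightness at the two marked points (`GermTight D a b a ∧ GermTight D a b b`, registered stub
`stub_germTight`, route child `GermTightness`) as an INPUT and produces per-shell eventual tightness (`EventualShellTight D a b`).
This file proves the converse direction of that bookkeeping: **per-shell eventual tightness implies germ tightness at both marked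
points** (`germTight_of_eventualShellTight`).  Consequently germ tightness is a NECESSARY condition for the crux's conclusion at
the approximation at hand, not an independent conjecture (the docstring remark "NOT implied by (H1)" in the skeleton is corrected
by this file together with `eventualShellTight_of_h1At`).

**Proof.**  The germ shell `D(δ·e_δ; ι(δ), r)` (`ι(δ) = 2·dist(δe_δ, ℂ ∖ D) + 4δ`) has a MOVING centre and a SHRINKING inner
radius, but every one of its separate traversals contains a traversal of the FIXED shell `D(e; r₀/4, r₀/2)` about the marked
point `e = D.pt i` (`r₀ = min r 1`), as soon as `dist(δe_δ, e) ≤ r₀/8` and `ι(δ) ≤ r₀/8` — both hold eventually because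
`δe_δ → e` (`IsEndpointApprox`) and `dist(δe_δ, ℂ ∖ D) ≤ dist(δe_δ, e)` (`e` lies on the frontier of the open set `D`, hence
in its complement).  This is `Curve.HasTraversals.mono` with a moving centre (Aizenman–Burchard's discretisation step); so the
traversal event of the germ shell is contained in that of the fixed shell, whose probability `EventualShellTight` makes `≤ ε`
for a suitable threshold.  No `sorry`, no definition, no named literature fact; standard axioms.
-/

noncomputable section

open MeasureTheory Filter Topology Set Metric
open scoped NNReal ENNReal
open Literature.Probability.LatticeModels
open Literature.Probability.RandomPlanarGeometry
open Literature.Probability.RandomPlanarGeometry.SAW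

namespace Summit.CriticalPhenomena.SAWScalingLimit.Theorems.FKGToTraversalBound.SlitNecklace

/-- A marked point of a Dobrushin domain lies in the complement of the (open) carrier: it is a boundary point, and the
frontier of an open set misses the set. [folklore] -/
theorem pt_mem_compl_carrier (D : DobrushinDomain) (i : Fin 2) : D.pt i ∈ D.carrierᶜ := by
  have hfr : D.pt i ∈ frontier D.carrier := D.boundary_mem_frontier (D.mark i)
  rw [D.isOpen.frontier_eq] at hfr
  exact hfr.2

/-- The depth of a lattice point is at most its distance to any marked point. [folklore] -/
theorem infDist_compl_le_dist_pt (D : DobrushinDomain) (i : Fin 2) (z : ℂ) :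
    infDist z D.carrierᶜ ≤ dist z (D.pt i) :=
  infDist_le_dist_of_mem (pt_mem_compl_carrier D i)

/-- **Germ tightness at ONE marked point from per-shell eventual tightness.**  If the mesh points `δ·e_δ` converge to the
marked point `D.pt i`, then `EventualShellTight D a b → GermTight D a b e`: eventually every separate traversal of the germ shell
`D(δe_δ; ι(δ), r)` contains a traversal of the fixed shell `D(D.pt i; r₀/4, r₀/2)`, `r₀ = min r 1`
(`Curve.HasTraversals.mono` with a moving centre), whose count is tight by hypothesis. [folklore] -/
theorem germTight_of_eventualShellTight_of_tendsto {D : DobrushinDomain} {a b e : ℝ → Site 2} {i : Fin 2}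
    (he : Tendsto (fun δ => meshPoint δ (e δ)) (𝓝[>] (0 : ℝ)) (𝓝 (D.pt i)))
    (hT : EventualShellTight D a b) : GermTight D a b e := by
  intro r hr ε hε
  set r₀ : ℝ := min r 1 with hr₀_def
  have hr₀ : 0 < r₀ := lt_min hr one_pos
  have hr₀r : r₀ ≤ r := min_le_left r 1
  have hr₀1 : r₀ ≤ 1 := min_le_right r 1
  -- the fixed shell `D(e; r₀/4, r₀/2)` has modulus `2`, positive inner radius and outer radius `≤ 1`
  obtain ⟨n, hn⟩ := hT (D.pt i) (r₀ / 4) (r₀ / 2) (by positivity) (by linarith) (by linarith) ε hε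
  refine ⟨n, ?_⟩
  -- eventually the centre is within `r₀/8` of the marked point and `δ < r₀/64`
  have hnear : ∀ᶠ δ in 𝓝[>] (0 : ℝ), dist (meshPoint δ (e δ)) (D.pt i) < r₀ / 16 :=
    (Metric.tendsto_nhds.1 he) (r₀ / 16) (by positivity)
  have hsmall : Set.Ioo (0 : ℝ) (r₀ / 64) ∈ 𝓝[>] (0 : ℝ) := Ioo_mem_nhdsGT (by positivity)
  filter_upwards [hn, hnear, hsmall] with δ hδn hδnear hδsmall
  refine le_trans (measure_mono ?_) hδn
  intro γ hγ
  simp only [Set.mem_setOf_eq] at hγ ⊢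
  have hι0 : 0 ≤ infDist (meshPoint δ (e δ)) D.carrierᶜ := infDist_nonneg
  have hι : infDist (meshPoint δ (e δ)) D.carrierᶜ ≤ dist (meshPoint δ (e δ)) (D.pt i) :=
    infDist_compl_le_dist_pt D i _
  -- shrink the outer radius to `r₀`, then move the centre
  have h1 : (polyline γ).HasTraversals n (meshPoint δ (e δ))
      (2 * infDist (meshPoint δ (e δ)) D.carrierᶜ + 4 * δ) r₀ := hγ.mono' le_rfl hr₀r
  refine h1.mono ?_ ?_
  · linarith [hδsmall.2]
  · linarith

/-- **Registered stub `germTight_of_eventualShellTight`** — germ tightness at BOTH marked points is NECESSARY for per-shell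
eventual tightness of an endpoint approximation: `EventualShellTight D a b → GermTight D a b a ∧ GermTight D a b b` under
`IsEndpointApprox D a b` (which supplies `δa_δ → D.pt 0`, `δb_δ → D.pt 1`). [folklore] -/
theorem germTight_of_eventualShellTight : ∀ (D : DobrushinDomain) (a b : ℝ → Site 2), IsEndpointApprox D a b →
    EventualShellTight D a b → GermTight D a b a ∧ GermTight D a b b := by
  intro D a b hab hT
  exact ⟨germTight_of_eventualShellTight_of_tendsto hab.tendsto_fst hT,
    germTight_of_eventualShellTight_of_tendsto hab.tendsto_snd hT⟩

end Summit.CriticalPhenomena.SAWScalingLimit.Theorems.FKGToTraversalBound.SlitNecklace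

end
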